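import Summits.CriticalPhenomena.PercolationContinuityZ3.Theorems.PercNearOneGluingNoHeavyPcintUFibAssembly
import HarnessLib

/-!
# PCINT lane, T-fibre route PHASE 2, step (4B): complete bipartite fibres `K_{A,B}` — the usable-set rule

Cell `prim-pcint`, seat `prim-pcint-1` (gen 12); memo `run/shared/lean/prim/pcint/T-FIBRE-ROUTE.md` (PHASE 2).

The fibre graph of the PHASE-2 cells is COMPLETE BIPARTITE: on a finite cell type `Φ` with a distinguished side
`SA ⊆ Φ`, `UFib.bipGraph SA` joins `a ∼ b` iff exactly one of them lies in `SA` (for `Φ = ZMod (4r)` and `SA` = the even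
residues this is `K_{2r,2r} = Cay(ℤ_{4r}, odd)`, a quotient of `ℤ^r`, so that `𝕋 × K_{2r,2r}` is covered by `ℤ^{3+r}`).
In a complete bipartite graph the open cluster structure of a fibre state `x` is explicit: if `x` has open cells on
both sides (`TwoSided`), ALL open cells form one cluster; otherwise the open cells are isolated.  Hence the exact
usable-set rule

  `υB SA x H = trueSet x`        if `x` meets `H` and is two-sided,
  `υB SA x H = trueSet x ∩ H`    if `x` meets `H` and is one-sided,      (`∅` if `x` does not meet `H`),

which is sound (`UFib.bipRule : RuleData (bipGraph SA)`: usable cells are open and joined inside the fibre to an open cell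
of `H`; the graph is connected from any root cell when both sides are nonempty).  The closed form of its type sums is
`…PcintUFibBipSum.lean`.
-/

namespace Summit.CriticalPhenomena.PercolationContinuityZ3.Theorems.Pcint

namespace UFib

open Finset AdaptDom

variable {Φ : Type*} [Fintype Φ] [DecidableEq Φ] (SA : Finset Φ)

/-- **The complete bipartite fibre graph** with sides `SA` and `SAᶜ`. -/
def bipGraph : SimpleGraph Φ where
  Adj a b := (a ∈ SA ∧ b ∉ SA) ∨ (a ∉ SA ∧ b ∈ SA)
  symm := ⟨fun _ _ h => h.elim (fun h => Or.inr ⟨h.2, h.1⟩) (fun h => Or.inl ⟨h.2, h.1⟩)⟩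
  loopless := ⟨fun _ h => h.elim (fun h => h.2 h.1) (fun h => h.1 h.2)⟩

omit [Fintype Φ] [DecidableEq Φ] in
/-- Adjacency in the complete bipartite fibre graph, unfolded. -/
theorem bipGraph_adj {a b : Φ} : (bipGraph SA).Adj a b ↔ (a ∈ SA ∧ b ∉ SA) ∨ (a ∉ SA ∧ b ∈ SA) := Iff.rfl

omit [Fintype Φ] [DecidableEq Φ] in
/-- Adjacency in the complete bipartite fibre graph is decidable. -/
instance instDecidableRelBipGraphAdj : DecidableRel (bipGraph SA).Adj := fun a b =>
  inferInstanceAs (Decidable ((a ∈ SA ∧ b ∉ SA) ∨ (a ∉ SA ∧ b ∈ SA)))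

/-- A fibre state is **two-sided** if it has open cells on both sides. -/
def TwoSided (x : Φ → Bool) : Prop := (trueSet x ∩ SA).Nonempty ∧ (trueSet x \ SA).Nonempty

/-- Two-sidedness is decidable. -/
instance instDecidablePredTwoSided : DecidablePred (TwoSided SA) := fun x =>
  inferInstanceAs (Decidable ((trueSet x ∩ SA).Nonempty ∧ (trueSet x \ SA).Nonempty))

/-- **The usable-set rule of complete bipartite fibres**: all open cells if the (met) fibre is two-sided, the met open
cells of `H` if it is one-sided, nothing if it does not meet `H`. -/
def υB (x : Φ → Bool) (H : Finset Φ) : Finset Φ :=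
  if meetsU x H = true then (if TwoSided SA x then trueSet x else trueSet x ∩ H) else ∅

variable {SA}

/-- Usable cells are open. -/
theorem υB_open (x : Φ → Bool) (H : Finset Φ) (j : Φ) (hj : j ∈ υB SA x H) : x j = true := by
  unfold υB at hj
  split_ifs at hj with h1 h2
  · exact mem_trueSet.1 hj
  · exact mem_trueSet.1 (mem_inter.1 hj).1
  · simp at hj

omit [Fintype Φ] [DecidableEq Φ] in
/-- Two open cells on opposite sides are joined by one open step. -/
theorem rtg_of_opposite {x : Φ → Bool} {i j : Φ} (hj : x j = true) (h : (i ∈ SA ∧ j ∉ SA) ∨ (i ∉ SA ∧ j ∈ SA)) :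
    Relation.ReflTransGen (fun a b => (bipGraph SA).Adj a b ∧ x b = true) i j :=
  Relation.ReflTransGen.single ⟨(bipGraph_adj SA).2 h, hj⟩

/-- In a two-sided fibre state every open cell is joined to every open cell through open cells. -/
theorem rtg_of_twoSided {x : Φ → Bool} (hx : TwoSided SA x) {i j : Φ} (hi : x i = true) (hj : x j = true) :
    Relation.ReflTransGen (fun a b => (bipGraph SA).Adj a b ∧ x b = true) i j := by
  obtain ⟨⟨ka, hka⟩, ⟨kb, hkb⟩⟩ := hx
  rw [mem_inter, mem_trueSet] at hka
  rw [mem_sdiff, mem_trueSet] at hkb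
  by_cases hiA : i ∈ SA
  · by_cases hjA : j ∈ SA
    · -- `i → kb → j`
      exact (rtg_of_opposite hkb.1 (Or.inl ⟨hiA, hkb.2⟩)).trans (rtg_of_opposite hj (Or.inr ⟨hkb.2, hjA⟩))
    · exact rtg_of_opposite hj (Or.inl ⟨hiA, hjA⟩)
  · by_cases hjA : j ∈ SA
    · exact rtg_of_opposite hj (Or.inr ⟨hiA, hjA⟩)
    · -- `i → ka → j`
      have _ := hi
      exact (rtg_of_opposite hka.1 (Or.inr ⟨hiA, hka.2⟩)).trans (rtg_of_opposite hj (Or.inl ⟨hka.2, hjA⟩))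

/-- Usable cells are joined inside the fibre, through open cells, to an open cell of the parent set `H`. -/
theorem υB_joined (x : Φ → Bool) (H : Finset Φ) (j : Φ) (hj : j ∈ υB SA x H) :
    ∃ i ∈ H, x i = true ∧ Relation.ReflTransGen (fun a b => (bipGraph SA).Adj a b ∧ x b = true) i j := by
  unfold υB at hj
  split_ifs at hj with h1 h2
  · obtain ⟨i, hiH, hxi⟩ := meetsU_eq_true_iff.1 h1
    exact ⟨i, hiH, hxi, rtg_of_twoSided h2 hxi (mem_trueSet.1 hj)⟩
  · rw [mem_inter, mem_trueSet] at hj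
    exact ⟨j, hj.2, hj.1, Relation.ReflTransGen.refl⟩
  · simp at hj

omit [Fintype Φ] [DecidableEq Φ] in
/-- The complete bipartite graph is connected from a cell of `SA` as soon as the other side is nonempty. -/
theorem bipGraph_conn {i₀ : Φ} (hi₀ : i₀ ∈ SA) {b₀ : Φ} (hb₀ : b₀ ∉ SA) (j : Φ) :
    Relation.ReflTransGen (bipGraph SA).Adj i₀ j := by
  by_cases hj : j ∈ SA
  · exact (Relation.ReflTransGen.single ((bipGraph_adj SA).2 (Or.inl ⟨hi₀, hb₀⟩))).trans
      (Relation.ReflTransGen.single ((bipGraph_adj SA).2 (Or.inr ⟨hb₀, hj⟩)))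
  · exact Relation.ReflTransGen.single ((bipGraph_adj SA).2 (Or.inl ⟨hi₀, hj⟩))

variable (SA) in
/-- **The sound usable-set rule of complete bipartite fibres** (`UFib.RuleData` for `bipGraph SA` with root cell
`i₀ ∈ SA`; the other side must be nonempty). -/
def bipRule (i₀ : Φ) (hi₀ : i₀ ∈ SA) (b₀ : Φ) (hb₀ : b₀ ∉ SA) : RuleData (bipGraph SA) where
  υ := υB SA
  i₀ := i₀
  open_of_mem := υB_open
  joined := υB_joined
  conn := bipGraph_conn hi₀ hb₀

/-- The rule of `bipRule` is `υB`. -/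
@[simp] theorem bipRule_υ (i₀ : Φ) (hi₀ : i₀ ∈ SA) (b₀ : Φ) (hb₀ : b₀ ∉ SA) : (bipRule SA i₀ hi₀ b₀ hb₀).υ = υB SA := rfl

/-- The root cell of `bipRule` is `i₀`. -/
@[simp] theorem bipRule_i₀ (i₀ : Φ) (hi₀ : i₀ ∈ SA) (b₀ : Φ) (hb₀ : b₀ ∉ SA) : (bipRule SA i₀ hi₀ b₀ hb₀).i₀ = i₀ := rfl

/-! ### The rule on indicator configurations -/

omit [Fintype Φ] in
/-- `meetsU (𝟙_A) H ↔ (A ∩ H).Nonempty`. -/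
theorem meetsU_indB_iff (A H : Finset Φ) : meetsU (indB A) H = true ↔ (A ∩ H).Nonempty := by
  rw [meetsU_eq_true_iff]
  constructor
  · rintro ⟨i, hiH, hi⟩; exact ⟨i, mem_inter.2 ⟨indB_apply_eq_true.1 hi, hiH⟩⟩
  · rintro ⟨i, hi⟩; exact ⟨i, (mem_inter.1 hi).2, indB_apply_eq_true.2 (mem_inter.1 hi).1⟩

/-- `trueSet (𝟙_A) = A`. -/
theorem trueSet_indB (A : Finset Φ) : trueSet (indB A) = A := trueSetEquiv.right_inv A

/-- `TwoSided (𝟙_A) ↔ (A ∩ SA).Nonempty ∧ (A \ SA).Nonempty`. -/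
theorem twoSided_indB_iff (A : Finset Φ) : TwoSided SA (indB A) ↔ (A ∩ SA).Nonempty ∧ (A \ SA).Nonempty := by
  unfold TwoSided; rw [trueSet_indB]

/-- **The size of the usable set of an indicator configuration.** -/
theorem card_υB_indB (A H : Finset Φ) :
    (υB SA (indB A) H).card =
      if (A ∩ H).Nonempty then (if (A ∩ SA).Nonempty ∧ (A \ SA).Nonempty then A.card else (A ∩ H).card) else 0 := by
  unfold υB
  rw [trueSet_indB]
  by_cases h1 : (A ∩ H).Nonempty
  · rw [if_pos ((meetsU_indB_iff A H).2 h1), if_pos h1]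
    by_cases h2 : (A ∩ SA).Nonempty ∧ (A \ SA).Nonempty
    · rw [if_pos ((twoSided_indB_iff A).2 h2), if_pos h2]
    · rw [if_neg (fun h => h2 ((twoSided_indB_iff A).1 h)), if_neg h2]
  · have : ¬ meetsU (indB A) H = true := fun h => h1 ((meetsU_indB_iff A H).1 h)
    rw [if_neg this, if_neg h1, card_empty]

end UFib

end Summit.CriticalPhenomena.PercolationContinuityZ3.Theorems.Pcint
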